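import Mathlib
import Summits.Ventures.PercRepro2.TypedBHKHalf
import Summits.Ventures.PercRepro2.TB14Fold

/-!
# Typed BHK 1.4 single-vertex on the INDEPENDENT CLASS — I: the involution `Φ`
(p5 g3, 2026-08-25; P5-SHAPE.md §9–§10; file 1 of 4: TypedBHKIndepFlip → TypedBHKIndepSrc →
TypedBHKIndepCluster → TypedBHKIndep)

The class `IndepClass`: every edge at an unmarked vertex (outside the four marks `{a₁, a₂, b, o}`)
has its other end marked, is not a loop and is the only edge with these ends. The flip set of a
configuration `y`: the mark–mark edges at `o` and all edges at each unmarked neighbour `u` of `o`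
whose edge to `o` shares its colour with another edge at `u` (`sharesColourAtO`). `Φ y`
complements the free edges of the flip set. THIS FILE: the definitions, `Φ` is an involution
preserving admissibility, and the bookkeeping lemmas on second-copy openness (`open2_*`), the
closed-unflipped configuration `cuf`, and `IsSource` (the source event of the fold).
-/

namespace Summit.Ventures.PercRepro2

namespace TypedBHKIndep

open CovForm A3InactiveTyped TB14Fold

section Defs

variable {V : Type*} {E : Type*} [DecidableEq E] [DecidableEq V]

/-- The four marks. -/
def marks (a₁ a₂ b o : V) : Set V := {a₁, a₂, b, o}

/-- **The independent class**: every edge at an unmarked vertex `u` has its other end marked,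
is not a loop, and is the only edge with these ends (single edges at unmarked vertices). -/
def IndepClass (ends : E → Sym2 V) (a₁ a₂ b o : V) : Prop :=
  ∀ e (u : V), u ∈ ends e → u ∉ marks a₁ a₂ b o →
    (∀ v ∈ ends e, v ≠ u → v ∈ marks a₁ a₂ b o) ∧ ends e ≠ s(u, u) ∧
      ∀ e', ends e' = ends e → e' = e

/-- `e` is a mark–mark edge at `o`. -/
def markEdgeAtO (ends : E → Sym2 V) (a₁ a₂ b o : V) (e : E) : Prop :=
  o ∈ ends e ∧ ∀ v ∈ ends e, v ∈ marks a₁ a₂ b o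

/-- `o` is NOT a singleton colour class at `u`: some edge `e₀` at `u` goes to `o` and another edge
`e ≠ e₀` at `u` has the same colour in `y`. -/
def sharesColourAtO (ends : E → Sym2 V) (o : V) (y : Config E) (u : V) : Prop :=
  ∃ e₀, u ∈ ends e₀ ∧ o ∈ ends e₀ ∧ ∃ e, u ∈ ends e ∧ e ≠ e₀ ∧ y e = y e₀

/-- The flip set of `y`: the mark–mark edges at `o`, and every edge at an unmarked vertex `u`
adjacent to `o` with `sharesColourAtO`. -/
def flipSet (ends : E → Sym2 V) (a₁ a₂ b o : V) (y : Config E) : Set E :=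
  {e | markEdgeAtO ends a₁ a₂ b o e} ∪
    {e | ∃ u, u ∈ ends e ∧ u ∉ marks a₁ a₂ b o ∧ sharesColourAtO ends o y u}

open Classical in
/-- **The involution `Φ`**: complement the free edges of the flip set. -/
noncomputable def Φ (ends : E → Sym2 V) (a₁ a₂ b o : V) (F : Finset E) (y : Config E) : Config E :=
  fun e => if e ∈ F ∧ e ∈ flipSet ends a₁ a₂ b o y then !(y e) else y e

variable (ends : E → Sym2 V) (a₁ a₂ b o : V) (F : Finset E)

omit [DecidableEq V] in
/-- `Φ` complements a free edge of the flip set. -/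
lemma Φ_of_mem {y : Config E} {e : E} (hF : e ∈ F) (he : e ∈ flipSet ends a₁ a₂ b o y) :
    Φ ends a₁ a₂ b o F y e = !(y e) := by
  unfold Φ; rw [if_pos ⟨hF, he⟩]

omit [DecidableEq V] in
/-- `Φ` keeps an edge that is not «free and in the flip set». -/
lemma Φ_of_not {y : Config E} {e : E} (he : ¬ (e ∈ F ∧ e ∈ flipSet ends a₁ a₂ b o y)) :
    Φ ends a₁ a₂ b o F y e = y e := by
  unfold Φ; rw [if_neg he]

omit [DecidableEq V] in
/-- `Φ` keeps pinned edges. -/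
lemma Φ_of_notMem {y : Config E} {e : E} (he : e ∉ F) : Φ ends a₁ a₂ b o F y e = y e :=
  Φ_of_not ends a₁ a₂ b o F (fun h => he h.1)

open Classical in
/-- Flipping all free edges at `u` preserves `sharesColourAtO` at `u` — provided every edge at
`u` is free (the all-free hypothesis `hF`), both sides of `y e = y e₀` are complemented. Edges at
a vertex `u` with `sharesColourAtO` are exactly the flipped ones among the edges at `u`. -/
lemma sharesColourAtO_Φ (hF : ∀ e, e ∈ F) (hcls : IndepClass ends a₁ a₂ b o) (y : Config E)
    (u : V) (hu : u ∉ marks a₁ a₂ b o) :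
    sharesColourAtO ends o (Φ ends a₁ a₂ b o F y) u ↔ sharesColourAtO ends o y u := by
  -- every edge at u is flipped iff sharesColourAtO y u (the mark–mark part of the flip set never
  -- contains an edge at the unmarked u); so all edges at u change colour together or none does.
  have key : ∀ e, u ∈ ends e →
      (Φ ends a₁ a₂ b o F y e = (if sharesColourAtO ends o y u then !(y e) else y e)) := by
    intro e hue
    by_cases hs : sharesColourAtO ends o y u
    · rw [if_pos hs]
      exact Φ_of_mem ends a₁ a₂ b o F (hF e) (Or.inr ⟨u, hue, hu, hs⟩)
    · rw [if_neg hs]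
      apply Φ_of_not
      rintro ⟨-, h | ⟨u', hu'e, hu'm, hs'⟩⟩
      · -- a mark–mark edge at o cannot contain the unmarked u
        exact hu (h.2 u hue)
      · -- the other unmarked end u' of e must be u itself (the class: the other end of an edge at
        -- an unmarked vertex is marked)
        by_cases huu : u' = u
        · subst huu; exact hs hs'
        · exact hu'm ((hcls e u hue hu).1 u' hu'e huu)
  constructor
  · rintro ⟨e₀, hue₀, hoe₀, e, hue, hne, heq⟩
    refine ⟨e₀, hue₀, hoe₀, e, hue, hne, ?_⟩
    rw [key e hue, key e₀ hue₀] at heq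
    by_cases hs : sharesColourAtO ends o y u
    · rw [if_pos hs, if_pos hs] at heq; simpa using heq
    · rw [if_neg hs, if_neg hs] at heq; exact heq
  · rintro ⟨e₀, hue₀, hoe₀, e, hue, hne, heq⟩
    refine ⟨e₀, hue₀, hoe₀, e, hue, hne, ?_⟩
    rw [key e hue, key e₀ hue₀]
    by_cases hs : sharesColourAtO ends o y u
    · rw [if_pos hs, if_pos hs, heq]
    · rw [if_neg hs, if_neg hs]; exact heq

/-- The flip set is invariant under `Φ` (all-free case). -/
lemma flipSet_Φ (hF : ∀ e, e ∈ F) (hcls : IndepClass ends a₁ a₂ b o) (y : Config E) :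
    flipSet ends a₁ a₂ b o (Φ ends a₁ a₂ b o F y) = flipSet ends a₁ a₂ b o y := by
  ext e
  simp only [flipSet, Set.mem_union, Set.mem_setOf_eq]
  constructor
  · rintro (h | ⟨u, hue, hum, hs⟩)
    · exact Or.inl h
    · exact Or.inr ⟨u, hue, hum, (sharesColourAtO_Φ ends a₁ a₂ b o F hF hcls y u hum).1 hs⟩
  · rintro (h | ⟨u, hue, hum, hs⟩)
    · exact Or.inl h
    · exact Or.inr ⟨u, hue, hum, (sharesColourAtO_Φ ends a₁ a₂ b o F hF hcls y u hum).2 hs⟩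

/-- `Φ` is an involution (all-free case). -/
lemma Φ_Φ (hF : ∀ e, e ∈ F) (hcls : IndepClass ends a₁ a₂ b o) (y : Config E) :
    Φ ends a₁ a₂ b o F (Φ ends a₁ a₂ b o F y) = y := by
  funext e
  by_cases he : e ∈ F ∧ e ∈ flipSet ends a₁ a₂ b o y
  · have h1 : Φ ends a₁ a₂ b o F y e = !(y e) := Φ_of_mem ends a₁ a₂ b o F he.1 he.2
    have h2 : Φ ends a₁ a₂ b o F (Φ ends a₁ a₂ b o F y) e = !(Φ ends a₁ a₂ b o F y e) := by
      apply Φ_of_mem ends a₁ a₂ b o F he.1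
      rw [flipSet_Φ ends a₁ a₂ b o F hF hcls]; exact he.2
    rw [h2, h1, Bool.not_not]
  · have h1 : Φ ends a₁ a₂ b o F y e = y e := Φ_of_not ends a₁ a₂ b o F he
    have he' : ¬ (e ∈ F ∧ e ∈ flipSet ends a₁ a₂ b o (Φ ends a₁ a₂ b o F y)) := by
      rw [flipSet_Φ ends a₁ a₂ b o F hF hcls]; exact he
    rw [Φ_of_not ends a₁ a₂ b o F he', h1]

omit [DecidableEq V] in
/-- `Φ` preserves admissibility. -/
lemma Φ_admissible_iff (z y : Config E) :
    (∀ e, e ∉ F → Φ ends a₁ a₂ b o F y e = z e) ↔ (∀ e, e ∉ F → y e = z e) := by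
  constructor
  · intro h e he; rw [← Φ_of_notMem ends a₁ a₂ b o F (y := y) he]; exact h e he
  · intro h e he; rw [Φ_of_notMem ends a₁ a₂ b o F he]; exact h e he

end Defs

section Clusters

variable {V : Type} {E : Type} [Fintype E] [DecidableEq E] [DecidableEq V]
variable (ends : E → Sym2 V) (a₁ a₂ b o : V) (F : Finset E)

/-- A SOURCE: `Q` in both copies, `b ∈ C₁(y)`, `o ∈ C₂(y)`, `o ∉ C₂(w)` (`w = flipOn F y`). -/
structure IsSource (y : Config E) : Prop where
  q₁ : ¬ Conn ends y a₁ a₂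
  q₂ : ¬ Conn ends (flipOn F y) a₁ a₂
  hb : Conn ends y a₁ b
  ho : Conn ends y a₂ o
  ho' : ¬ Conn ends (flipOn F y) a₂ o

omit [DecidableEq V] in
/-- Membership in the four marks. -/
lemma mem_marks {a₁ a₂ b o v : V} : v ∈ marks a₁ a₂ b o ↔ v = a₁ ∨ v = a₂ ∨ v = b ∨ v = o := by
  simp [marks]

omit [Fintype E] [DecidableEq V] in
/-- An edge of the flip set that is open in `y` is open in the SECOND copy of `Φ y`. -/
lemma open2_of_flipped (hF : ∀ e, e ∈ F) {y : Config E} {e : E}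
    (he : e ∈ flipSet ends a₁ a₂ b o y) (hy : y e = true) :
    flipOn F (Φ ends a₁ a₂ b o F y) e = true := by
  unfold flipOn
  rw [if_pos (hF e), Φ_of_mem ends a₁ a₂ b o F (hF e) he, hy]
  rfl

omit [Fintype E] [DecidableEq V] in
/-- An edge outside the flip set that is closed in `y` is open in the SECOND copy of `Φ y`. -/
lemma open2_of_unflipped (hF : ∀ e, e ∈ F) {y : Config E} {e : E}
    (he : e ∉ flipSet ends a₁ a₂ b o y) (hy : y e = false) :
    flipOn F (Φ ends a₁ a₂ b o F y) e = true := by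
  unfold flipOn
  rw [if_pos (hF e), Φ_of_not ends a₁ a₂ b o F (fun h => he h.2), hy]
  rfl

omit [Fintype E] [DecidableEq V] in
/-- A `Φ`-open edge is either `y`-open and unflipped, or `y`-closed and flipped. -/
lemma Φ_open_cases (hF : ∀ e, e ∈ F) {y : Config E} {e : E} (he : Φ ends a₁ a₂ b o F y e = true) :
    (y e = true ∧ e ∉ flipSet ends a₁ a₂ b o y) ∨ (y e = false ∧ e ∈ flipSet ends a₁ a₂ b o y) := by
  by_cases hf : e ∈ F ∧ e ∈ flipSet ends a₁ a₂ b o y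
  · rw [Φ_of_mem ends a₁ a₂ b o F hf.1 hf.2] at he
    exact Or.inr ⟨by simpa using he, hf.2⟩
  · rw [Φ_of_not ends a₁ a₂ b o F hf] at he
    exact Or.inl ⟨he, fun h => hf ⟨hF e, h⟩⟩

omit [Fintype E] [DecidableEq V] in
/-- Helper: an open edge in `y` joining `x` and `w` whose vertex `x` is unmarked with an open edge
to `a₂` and an open edge to `o` is flipped, and so is every edge at `x` (all open edges at a
flipped vertex are open in the second copy of `Φ y`). -/
lemma open2_of_shares (hF : ∀ e, e ∈ F) {y : Config E} {u : V} (hu : u ∉ marks a₁ a₂ b o)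
    (hsh : sharesColourAtO ends o y u) {e : E} (hue : u ∈ ends e) (hy : y e = true) :
    flipOn F (Φ ends a₁ a₂ b o F y) e = true :=
  open2_of_flipped ends a₁ a₂ b o F hF (Or.inr ⟨u, hue, hu, hsh⟩) hy

open Classical in
/-- The closed-unflipped configuration: the `y`-closed edges outside the flip set, as open edges. -/
noncomputable def cuf (y : Config E) : Config E :=
  fun e => if e ∈ flipSet ends a₁ a₂ b o y then false else flipOn F y e

omit [Fintype E] [DecidableEq V] in
/-- The closed-unflipped configuration is below the second copy of `y`. -/
lemma cuf_le (y : Config E) : cuf ends a₁ a₂ b o F y ≤ flipOn F y := by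
  intro e
  unfold cuf
  split_ifs
  · exact Bool.false_le _
  · exact le_rfl

omit [Fintype E] [DecidableEq V] in
/-- An edge is open in the closed-unflipped configuration iff it is unflipped and `y`-closed. -/
lemma cuf_eq_true_iff (y : Config E) {e : E} :
    cuf ends a₁ a₂ b o F y e = true ↔ e ∉ flipSet ends a₁ a₂ b o y ∧ flipOn F y e = true := by
  unfold cuf
  split_ifs with h
  · simp [h]
  · simp [h]

omit [Fintype E] [DecidableEq V] in
/-- An edge open in the second copy of `Φ y` is `y`-open and flipped, or `y`-closed and unflipped. -/
lemma open2_cases (hF : ∀ e, e ∈ F) {y : Config E} {e : E}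
    (he : flipOn F (Φ ends a₁ a₂ b o F y) e = true) :
    (y e = true ∧ e ∈ flipSet ends a₁ a₂ b o y) ∨ (y e = false ∧ e ∉ flipSet ends a₁ a₂ b o y) := by
  unfold flipOn at he
  rw [if_pos (hF e)] at he
  by_cases hf : e ∈ flipSet ends a₁ a₂ b o y
  · rw [Φ_of_mem ends a₁ a₂ b o F (hF e) hf] at he
    exact Or.inl ⟨by simpa using he, hf⟩
  · rw [Φ_of_not ends a₁ a₂ b o F (fun h => hf h.2)] at he
    exact Or.inr ⟨by simpa using he, hf⟩

omit [Fintype E] [DecidableEq E] [DecidableEq V] in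
/-- The ends of an edge at an unmarked `u` containing `o` are `{u, o}`. -/
lemma ends_eq_of_unmarked_o {u : V} (hu : u ∉ marks a₁ a₂ b o)
    {e : E} (hue : u ∈ ends e) (hoe : o ∈ ends e) : ends e = s(u, o) := by
  obtain ⟨v, hv⟩ := Sym2.mem_iff_exists.1 hue
  rw [hv] at hoe ⊢
  rcases Sym2.mem_iff.1 hoe with h | h
  · exact absurd (h.symm ▸ mem_marks.2 (Or.inr (Or.inr (Or.inr rfl)))) hu
  · rw [h]

end Clusters

end TypedBHKIndep

end Summit.Ventures.PercRepro2
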